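import Mathlib
import Literature.RingTheory.TwoVariableSeries.Basic
import Summits.ResolutionOfSingularities.ResolutionOfSingularities.Theorems.WeightedInvariantLocalWeightedDropTOT2CurveConflictDivTwo
import Summits.ResolutionOfSingularities.ResolutionOfSingularities.Theorems.WeightedInvariantLocalWeightedDropNCPolyBridgeRepresents

/-!
# `LocalWeightedDrop`, TOT2-LINE regime (P), piece (B1b, mixed degrees): an `h`-INDEPENDENT WITNESS vanishing along every top-locus graph branch
# of a label — Frobenius regrouping of the branch congruence `P ≡ (y + φ)^d = (y^q + φ^q)^{m′}`

Crux item stmt-ResolutionOfSingularities-8899 `WeightedInvariant.LocalWeightedDrop` (route `ResolutionOfSingularities/WeightedInvariant`), ENGINE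
skeleton v33 (35b29332b4d99231), registered stub `stub_regimePresented`; TOT2-LINE v1.3 §3 (P3)/(B1) (`L/res-L1-w43-lead-1/g5/TOT2-LINE-v1.3.md`):
the finiteness of the graph-branch index set of res-type-088's conflict budget is «an `h`-independent non-zero `D ∈ k⟦u₁,u₂⟧` with `D(u₁,u₁h) = 0`
for every branch datum `h`» (this file and its purely-inseparable sequel) + the root count (`…TOT2CurveRootsFinite`, res-L1-w43-stub-1's
`…NCResCurveGraphFinite`).  [OURS · L1 W4.3 · chain w43 · seat res-L1-w43-lead-1 gen 5; def-free; elementary polynomial algebra over `k⟦u₁,u₂⟧`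
(`WildMonic.monicPoly`/`taylor_monicPoly`, res-type-088's `u₂`-free part `subst ![X 0, 0]`, `MonicDescent.shear`); nothing here is a statement of any
manuscript; AI-produced, gate-checked, weaker than expert review.]

SETTING.  `A : Fin d → k⟦u₁,u₂⟧` a label (monic form `P = y^d + Σ A_j y^j`), `char k = p` prime, `d = q·m′` with `q = p^{v_p(d)}`, `p ∤ m′`.  A GRAPH
DATUM is a `u₂`-free `h` with `IsPermissibleTwoT d (shift d (shearT h A) ψ)` for some `ψ` (the curve `V(y + ψ, u₂ + u₁h)` is equimultiple for `P`).
The EVALUATION along the branch is `E_h F := subst ![X 0, 0] (shear h F)` (`= F(u₁, u₁h)`).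
* `map_monicPoly_ringHom` — `monicPoly` commutes with ring maps of the coefficients;
* **`map_monicPoly_eq_X_add_C_pow`** — for a graph datum, `(monicPoly d A).map E_h = (X + C c)^d` for some `c` (kill `u₂` in the re-centred sheared
  monic polynomial: all lower coefficients die; undo the Taylor shift);
* `X_add_C_pow_eq_expand` — `(X + C c)^{q m′} = expand q ((X + C c^q)^{m′})` in characteristic `p` (`add_pow_char_pow`);
* **`eval_eq_zero_of_not_dvd`**, **`eval_deviation_eq_zero`** — hence `E_h(A_i) = 0` for `q ∤ i`, and `E_h(m′^{m′−j} A_{qj} − C(m′,j)·A_{d−q}^{m′−j}) = 0`;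
* **`exists_witness_or_insep`** — for `Squarefree (monicGerm d A)` and a position `A`: EITHER some such `h`-independent element is non-zero — a
  witness `D ≠ 0` with `E_h(D) = 0` for every graph datum `h` — OR `m′ = 1` and `A_i = 0` for `i ≠ 0` (the purely inseparable shape `y^q + A₀`,
  witnessed in the sequel); the excluded middle case `P = (y^q + a)^{m′}`, `m′ ≥ 2`, is not squarefree.
-/

set_option linter.dupNamespace false -- mandated namespace of this single-conjunct summit

noncomputable section

namespace Summit.ResolutionOfSingularities.ResolutionOfSingularities.Theorems

namespace TOT2Curve

open MvPowerSeries PolyDescent MonicDescent WildMonic Literature.AlgebraicGeometry.Resolution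

variable {k : Type} [Field k]

/-! ## `monicPoly` under ring maps; the evaluation as a ring map -/

/-- `monicPoly` commutes with ring maps of the coefficient tuple. -/
theorem map_monicPoly_ringHom {R S : Type*} [CommRing R] [CommRing S] (f : R →+* S) (d : ℕ) (A : Fin d → R) :
    (monicPoly d A).map f = monicPoly d (fun j => f (A j)) := by
  unfold monicPoly
  simp only [Polynomial.map_add, Polynomial.map_pow, Polynomial.map_X, Polynomial.map_sum, Polynomial.map_mul, Polynomial.map_C]

/-- The `u₂`-free part as a ring map. -/
theorem killTwoHom_apply (F : MvPowerSeries (Fin 2) k) :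
    (substAlgHom (hasSubst_killTwo (k := k))).toRingHom F = subst (![X 0, 0] : Fin 2 → MvPowerSeries (Fin 2) k) F := by
  rw [AlgHom.toRingHom_eq_coe, RingHom.coe_coe, substAlgHom_apply]

/-- The shear as a ring map. -/
theorem shearHom_apply (h F : MvPowerSeries (Fin 2) k) :
    (substAlgHom (hasSubst_of_constantCoeff_zero (constantCoeff_shearFamily h))).toRingHom F = shear h F := by
  rw [AlgHom.toRingHom_eq_coe, RingHom.coe_coe, substAlgHom_apply, shear_eq]

/-- THE EVALUATION ALONG `u₂ = u₁h` as a ring map: `E_h F = subst ![X 0, 0] (shear h F)`. -/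
theorem evalHom_apply (h F : MvPowerSeries (Fin 2) k) :
    ((substAlgHom (hasSubst_killTwo (k := k))).toRingHom.comp
        (substAlgHom (hasSubst_of_constantCoeff_zero (constantCoeff_shearFamily h))).toRingHom) F =
      subst (![X 0, 0] : Fin 2 → MvPowerSeries (Fin 2) k) (shear h F) := by
  rw [RingHom.comp_apply, shearHom_apply, killTwoHom_apply]

/-! ## The branch congruence: `P(u₁, u₁h; Y) = (Y + c)^d` -/

/-- **THE MONIC POLYNOMIAL ALONG A GRAPH BRANCH IS A `d`-TH POWER OF A LINEAR FORM**: if `V(y + ψ, u₂ + u₁h)` is permissible for the label `A`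
(`IsPermissibleTwoT d (shift d (shearT h A) ψ)`), then evaluating the coefficients along `u₂ = u₁h` gives `(monicPoly d A).map E_h = (X + C c)^d` with
`c = −ψ(u₁, u₁h)·` (precisely `c = −(u₂`-free part of `ψ)`). -/
theorem map_monicPoly_eq_X_add_C_pow {d : ℕ} {A : Fin d → MvPowerSeries (Fin 2) k} {h ψ : MvPowerSeries (Fin 2) k}
    (hperm : IsPermissibleTwoT d (shift d (shearT h A) ψ)) :
    (monicPoly d A).map ((substAlgHom (hasSubst_killTwo (k := k))).toRingHom.comp
        (substAlgHom (hasSubst_of_constantCoeff_zero (constantCoeff_shearFamily h))).toRingHom) =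
      (Polynomial.X + Polynomial.C (-(subst (![X 0, 0] : Fin 2 → MvPowerSeries (Fin 2) k) ψ))) ^ d := by
  set K : MvPowerSeries (Fin 2) k →+* MvPowerSeries (Fin 2) k := (substAlgHom (hasSubst_killTwo (k := k))).toRingHom with hK
  set S : MvPowerSeries (Fin 2) k →+* MvPowerSeries (Fin 2) k :=
    (substAlgHom (hasSubst_of_constantCoeff_zero (constantCoeff_shearFamily h))).toRingHom with hS
  have hKapp : ∀ F, K F = subst (![X 0, 0] : Fin 2 → MvPowerSeries (Fin 2) k) F := fun F => by rw [hK, killTwoHom_apply]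
  have hSapp : ∀ F, S F = shear h F := fun F => by rw [hS, shearHom_apply]
  set B := shift d (shearT h A) ψ with hB
  set φ : MvPowerSeries (Fin 2) k := subst (![X 0, 0] : Fin 2 → MvPowerSeries (Fin 2) k) ψ with hφ
  -- every lower coefficient of the re-centred sheared polynomial dies under `K`
  have hkill : ∀ j : Fin d, K (B j) = 0 := by
    intro j
    rw [hKapp]
    ext e
    rw [coeff_subst_killTwo, map_zero]
    split_ifs with he
    · by_contra hne
      have := hperm j e hne
      rw [he] at this
      have hj := j.2
      omega
    · rfl
  have hmapB : (monicPoly d B).map K = Polynomial.X ^ d := by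
    rw [map_monicPoly_ringHom]
    unfold monicPoly
    simp only [hkill, map_zero, zero_mul, Finset.sum_const_zero, add_zero]
  -- `monicPoly d B` is the Taylor shift of `monicPoly d (shearT h A)`, which is `(monicPoly d A).map S`
  have hshear : monicPoly d (shearT h A) = (monicPoly d A).map S := by
    rw [map_monicPoly_ringHom]
    congr 1
    funext j
    rw [hSapp]
    rfl
  have htaylor : monicPoly d B = ((monicPoly d A).map S).comp (Polynomial.X + Polynomial.C ψ) := by
    rw [hB, ← taylor_monicPoly, Polynomial.taylor_apply, hshear]
  -- map by `K`
  have hcomp : (((monicPoly d A).map S).map K).comp (Polynomial.X + Polynomial.C φ) = Polynomial.X ^ d := by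
    rw [← hmapB, htaylor, Polynomial.map_comp, Polynomial.map_add, Polynomial.map_X, Polynomial.map_C, hKapp ψ]
  rw [Polynomial.map_map] at hcomp
  -- undo the shift: compose with `X − C φ`
  have hundo : (Polynomial.X + Polynomial.C φ).comp (Polynomial.X + Polynomial.C (-φ)) = (Polynomial.X : Polynomial (MvPowerSeries (Fin 2) k)) := by
    rw [Polynomial.add_comp, Polynomial.X_comp, Polynomial.C_comp, map_neg, neg_add_cancel_right]
  calc (monicPoly d A).map (K.comp S)
      = ((monicPoly d A).map (K.comp S)).comp Polynomial.X := by rw [Polynomial.comp_X]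
    _ = (((monicPoly d A).map (K.comp S)).comp (Polynomial.X + Polynomial.C φ)).comp (Polynomial.X + Polynomial.C (-φ)) := by
        rw [Polynomial.comp_assoc, hundo]
    _ = (Polynomial.X + Polynomial.C (-φ)) ^ d := by rw [hcomp, Polynomial.X_pow_comp]

/-! ## Frobenius regrouping of `(X + C c)^d` -/

/-- In characteristic `p`: `(X + C c)^{p^n · m} = expand (p^n) ((X + C (c^{p^n}))^m)`. -/
theorem X_add_C_pow_eq_expand {R : Type*} [CommRing R] (p : ℕ) [Fact p.Prime] [CharP R p] (c : R) (n m : ℕ) :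
    (Polynomial.X + Polynomial.C c : Polynomial R) ^ (p ^ n * m) =
      Polynomial.expand R (p ^ n) ((Polynomial.X + Polynomial.C (c ^ p ^ n)) ^ m) := by
  rw [pow_mul, add_pow_char_pow (Polynomial.X : Polynomial R) (Polynomial.C c) p n, map_pow, map_add, Polynomial.expand_X,
    Polynomial.expand_C, ← Polynomial.C_pow]

/-- The coefficients of `(X + C c)^{q·m}` (`q = p^n`): zero off the multiples of `q`, `c^{q(m − i/q)}·C(m, i/q)` at `i = q·(i/q)`. -/
theorem coeff_X_add_C_pow_charPow {R : Type*} [CommRing R] (p : ℕ) [Fact p.Prime] [CharP R p] (c : R) (n m i : ℕ) :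
    ((Polynomial.X + Polynomial.C c : Polynomial R) ^ (p ^ n * m)).coeff i =
      if p ^ n ∣ i then (c ^ p ^ n) ^ (m - i / p ^ n) * (m.choose (i / p ^ n) : R) else 0 := by
  rw [X_add_C_pow_eq_expand, Polynomial.coeff_expand (pow_pos (Fact.out : p.Prime).pos n)]
  split_ifs with hdvd
  · rw [Polynomial.coeff_X_add_C_pow]
  · rfl

/-! ## The relations killed along every branch -/

section Relations

variable (p : ℕ) [Fact p.Prime] [CharP k p] {d : ℕ} {A : Fin d → MvPowerSeries (Fin 2) k} {h ψ : MvPowerSeries (Fin 2) k}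

omit [Fact p.Prime] in
/-- `k⟦u₁,u₂⟧` has characteristic `p` (a theorem, not an instance: introduced with `haveI` where used). -/
theorem charP_R₂ : CharP (MvPowerSeries (Fin 2) k) p :=
  Literature.RingTheory.TwoVariableSeries.charP_mvPowerSeries (R := k) (Fin 2) p

/-- **COEFFICIENTS OFF THE MULTIPLES OF `q` VANISH ALONG EVERY BRANCH**: `q ∤ i ⇒ A_i(u₁, u₁h) = 0` (`q = p^{v_p(d)}`). -/
theorem eval_eq_zero_of_not_dvd (hperm : IsPermissibleTwoT d (shift d (shearT h A) ψ)) (i : Fin d)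
    (hi : ¬ p ^ d.factorization p ∣ (i : ℕ)) :
    subst (![X 0, 0] : Fin 2 → MvPowerSeries (Fin 2) k) (shear h (A i)) = 0 := by
  haveI := charP_R₂ (k := k) p
  have hmap := map_monicPoly_eq_X_add_C_pow hperm
  have hcoef := congrArg (fun P => Polynomial.coeff P (i : ℕ)) hmap
  simp only [Polynomial.coeff_map, coeff_monicPoly_of_lt] at hcoef
  rw [evalHom_apply] at hcoef
  have key := coeff_X_add_C_pow_charPow p (-(subst (![X 0, 0] : Fin 2 → MvPowerSeries (Fin 2) k) ψ)) (d.factorization p)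
    (d / p ^ d.factorization p) (i : ℕ)
  rw [Nat.ordProj_mul_ordCompl_eq_self d p, if_neg hi] at key
  rw [hcoef, key]

/-- **THE ELEMENTARY DEVIATIONS VANISH ALONG EVERY BRANCH**: with `d = q·m′`, for `j < m′`,
`E_h(m′^{m′−j} · A_{qj} − C(m′,j) · A_{d−q}^{m′−j}) = 0`. -/
theorem eval_deviation_eq_zero (hperm : IsPermissibleTwoT d (shift d (shearT h A) ψ)) (hd : d ≠ 0) (j : ℕ)
    (hqj : p ^ d.factorization p * j < d) (hdq : d - p ^ d.factorization p < d) :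
    subst (![X 0, 0] : Fin 2 → MvPowerSeries (Fin 2) k)
      (shear h (((d / p ^ d.factorization p : ℕ) : MvPowerSeries (Fin 2) k) ^ (d / p ^ d.factorization p - j) * A ⟨_, hqj⟩ -
        ((d / p ^ d.factorization p).choose j : MvPowerSeries (Fin 2) k) * A ⟨_, hdq⟩ ^ (d / p ^ d.factorization p - j))) = 0 := by
  haveI := charP_R₂ (k := k) p
  set q := p ^ d.factorization p with hq
  set m := d / p ^ d.factorization p with hm
  have hqm : q * m = d := Nat.ordProj_mul_ordCompl_eq_self d p
  have hqpos : 0 < q := pow_pos (Fact.out : p.Prime).pos _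
  have hmpos : 0 < m := Nat.ordCompl_pos p hd
  have hmap := map_monicPoly_eq_X_add_C_pow hperm
  set c : MvPowerSeries (Fin 2) k := -(subst (![X 0, 0] : Fin 2 → MvPowerSeries (Fin 2) k) ψ) with hc
  -- the two coefficient identities
  have hA : ∀ (i : Fin d), subst (![X 0, 0] : Fin 2 → MvPowerSeries (Fin 2) k) (shear h (A i)) =
      if q ∣ (i : ℕ) then (c ^ q) ^ (m - (i : ℕ) / q) * (m.choose ((i : ℕ) / q) : MvPowerSeries (Fin 2) k) else 0 := by
    intro i
    have hcoef := congrArg (fun P => Polynomial.coeff P (i : ℕ)) hmap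
    simp only [Polynomial.coeff_map, coeff_monicPoly_of_lt] at hcoef
    rw [evalHom_apply] at hcoef
    have key := coeff_X_add_C_pow_charPow p c (d.factorization p) (d / p ^ d.factorization p) (i : ℕ)
    rw [Nat.ordProj_mul_ordCompl_eq_self d p] at key
    rw [hcoef, key]
  have hAj : subst (![X 0, 0] : Fin 2 → MvPowerSeries (Fin 2) k) (shear h (A ⟨q * j, hqj⟩)) =
      (c ^ q) ^ (m - j) * (m.choose j : MvPowerSeries (Fin 2) k) := by
    rw [hA, if_pos (Dvd.intro j rfl)]
    simp only [Nat.mul_div_cancel_left j hqpos]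
  have hAtop : subst (![X 0, 0] : Fin 2 → MvPowerSeries (Fin 2) k) (shear h (A ⟨d - q, hdq⟩)) = c ^ q * (m : MvPowerSeries (Fin 2) k) := by
    have hdq' : d - q = q * (m - 1) := by
      rw [Nat.mul_sub, mul_one, hqm]
    have hdiv : (d - q) / q = m - 1 := by rw [hdq', Nat.mul_div_cancel_left _ hqpos]
    rw [hA, if_pos ⟨m - 1, hdq'⟩]
    simp only [hdiv]
    rw [show m - (m - 1) = 1 by omega, pow_one,
      show m.choose (m - 1) = m from by rw [Nat.choose_symm (by omega : 1 ≤ m), Nat.choose_one_right]]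
  -- assemble
  have hE := evalHom_apply (k := k) h
  rw [← hE, map_sub, map_mul, map_mul, map_pow, map_pow, map_natCast, map_natCast, hE, hE, hAj, hAtop]
  ring

end Relations

/-! ## The witness, or the purely inseparable shape -/

/-- **THE `h`-INDEPENDENT WITNESS (mixed degrees).**  For a position label `A` of degree `d ≥ 2` over a field of characteristic `p` whose monic germ is
SQUAREFREE: either there is `D ≠ 0` in `k⟦u₁,u₂⟧` with `D(u₁, u₁h) = 0` for EVERY graph datum `h` of `A` (so the graph data are finite in number,
`finite_curveRoots`), or `d = q` is a power of `p` and `A_i = 0` for all `i ≠ 0` — the purely inseparable shape `y^q + A₀` (sequel). -/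
theorem exists_witness_or_insep (p : ℕ) [Fact p.Prime] [CharP k p] {d : ℕ} (hd : 2 ≤ d) (A : Fin d → MvPowerSeries (Fin 2) k)
    (hpos : IsPosT d A) (hsq : Squarefree (NCPoly.monicGerm d A)) :
    (∃ D : MvPowerSeries (Fin 2) k, D ≠ 0 ∧ ∀ h : MvPowerSeries (Fin 2) k,
        (∃ ψ : MvPowerSeries (Fin 2) k, IsPermissibleTwoT d (shift d (shearT h A) ψ)) →
        subst (![X 0, 0] : Fin 2 → MvPowerSeries (Fin 2) k) (shear h D) = 0) ∨
      (d / p ^ d.factorization p = 1 ∧ ∀ i : Fin d, (i : ℕ) ≠ 0 → A i = 0) := by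
  classical
  haveI := charP_R₂ (k := k) p
  set q := p ^ d.factorization p with hq
  set m := d / p ^ d.factorization p with hm
  have hd0 : d ≠ 0 := by omega
  have hqm : q * m = d := Nat.ordProj_mul_ordCompl_eq_self d p
  have hqpos : 0 < q := pow_pos (Fact.out : p.Prime).pos _
  have hmpos : 0 < m := Nat.ordCompl_pos p hd0
  have hpm : ¬ p ∣ m := Nat.not_dvd_ordCompl (Fact.out : p.Prime) hd0
  have hmk' : (m : k) ≠ 0 := fun h0 => hpm ((CharP.cast_eq_zero_iff k p m).mp h0)
  have hmk : (m : MvPowerSeries (Fin 2) k) ≠ 0 := fun h0 => hpm ((CharP.cast_eq_zero_iff (MvPowerSeries (Fin 2) k) p m).mp h0)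
  -- (W1) a non-zero coefficient off the multiples of `q`
  by_cases hW1 : ∃ i : Fin d, ¬ q ∣ (i : ℕ) ∧ A i ≠ 0
  · obtain ⟨i, hi, hAi⟩ := hW1
    exact Or.inl ⟨A i, hAi, fun h ⟨ψ, hperm⟩ => eval_eq_zero_of_not_dvd p hperm i hi⟩
  push Not at hW1
  -- (W2) a non-zero elementary deviation
  have hdq : d - q < d := Nat.sub_lt (by omega) hqpos
  by_cases hW2 : ∃ (j : ℕ) (hj : j < m),
      ((m : ℕ) : MvPowerSeries (Fin 2) k) ^ (m - j) * A ⟨q * j, by rw [← hqm]; exact Nat.mul_lt_mul_of_pos_left hj hqpos⟩ -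
        (m.choose j : MvPowerSeries (Fin 2) k) * A ⟨d - q, hdq⟩ ^ (m - j) ≠ 0
  · obtain ⟨j, hj, hD⟩ := hW2
    refine Or.inl ⟨_, hD, fun h ⟨ψ, hperm⟩ => ?_⟩
    exact eval_deviation_eq_zero p hperm hd0 j _ hdq
  push Not at hW2
  -- (W3) all deviations vanish: `monicPoly d A = (X^q + C a)^m` with `a = A_{d−q}/m`
  set a : MvPowerSeries (Fin 2) k := C ((m : k)⁻¹) * A ⟨d - q, hdq⟩ with ha
  have hma : (m : MvPowerSeries (Fin 2) k) * a = A ⟨d - q, hdq⟩ := by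
    rw [ha, ← mul_assoc, ← map_natCast (C : k →+* MvPowerSeries (Fin 2) k) m, ← map_mul, mul_inv_cancel₀ hmk', map_one, one_mul]
  have hAqj : ∀ (j : ℕ) (hj : j < m), A ⟨q * j, by rw [← hqm]; exact Nat.mul_lt_mul_of_pos_left hj hqpos⟩ =
      (m.choose j : MvPowerSeries (Fin 2) k) * a ^ (m - j) := by
    intro j hj
    have h0 := hW2 j hj
    rw [sub_eq_zero, ← hma, mul_pow, mul_comm ((m : MvPowerSeries (Fin 2) k) ^ (m - j)), ← mul_assoc] at h0
    exact mul_right_cancel₀ (pow_ne_zero _ hmk) (by rw [h0]; ring)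
  have hpoly : monicPoly d A = Polynomial.expand (MvPowerSeries (Fin 2) k) q ((Polynomial.X + Polynomial.C a) ^ m) := by
    refine Polynomial.ext fun i => ?_
    rw [Polynomial.coeff_expand hqpos]
    rcases lt_trichotomy i d with hlt | heq | hgt
    · rw [show (monicPoly d A).coeff i = A ⟨i, hlt⟩ from coeff_monicPoly_of_lt d A ⟨i, hlt⟩]
      split_ifs with hdvd
      · obtain ⟨j, rfl⟩ := hdvd
        have hj : j < m := by
          by_contra hge; push Not at hge
          have : q * m ≤ q * j := Nat.mul_le_mul_left q hge
          omega
        rw [Nat.mul_div_cancel_left j hqpos, Polynomial.coeff_X_add_C_pow, hAqj j hj, mul_comm]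
      · exact hW1 ⟨i, hlt⟩ hdvd
    · rw [heq, coeff_monicPoly_self, if_pos ⟨m, hqm.symm⟩]
      have hdiv : d / q = m := by rw [← hqm, Nat.mul_div_cancel_left m hqpos]
      rw [hdiv, Polynomial.coeff_X_add_C_pow, Nat.sub_self, pow_zero, one_mul, Nat.choose_self, Nat.cast_one]
    · rw [coeff_monicPoly_of_gt d A hgt]
      split_ifs with hdvd
      · obtain ⟨j, rfl⟩ := hdvd
        rw [Nat.mul_div_cancel_left j hqpos, Polynomial.coeff_eq_zero_of_natDegree_lt]
        refine lt_of_le_of_lt (Polynomial.natDegree_pow_le_of_le m (Polynomial.natDegree_X_add_C a).le) ?_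
        rw [mul_one]
        by_contra hge; push Not at hge
        have : q * j ≤ q * m := Nat.mul_le_mul_left q hge
        omega
      · rfl
  -- the monic germ is then an `m`-th power
  rcases Nat.lt_or_ge 1 m with hm2 | hm1
  · exfalso
    -- evaluate `monicPoly` at `y`
    set ρ : MvPowerSeries (Fin 2) k →+* MvPowerSeries (Fin 3) k :=
      (rename (Fin.succAboveEmb (Fin.last 2)) : MvPowerSeries (Fin 2) k →ₐ[k] MvPowerSeries (Fin (2 + 1)) k).toRingHom with hρ
    have hgerm : NCPoly.monicGerm d A = (monicPoly d A).eval₂ ρ (X (Fin.last 2)) := by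
      rw [NCPoly.monicGerm, hρ, eval₂_monicPoly]
    set F : MvPowerSeries (Fin 3) k := X (Fin.last 2) ^ q + ρ a with hF
    have hpow : NCPoly.monicGerm d A = F ^ m := by
      rw [hgerm, hpoly, Polynomial.expand_eq_comp_X_pow, Polynomial.eval₂_comp, Polynomial.eval₂_X_pow, Polynomial.eval₂_pow,
        Polynomial.eval₂_add, Polynomial.eval₂_X, Polynomial.eval₂_C]
    exact absurd hsq (by
      rw [hpow]
      intro hsqF
      have hunit : IsUnit F := hsqF F ⟨F ^ (m - 2), by rw [← pow_two, ← pow_add]; congr 1; omega⟩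
      rw [MvPowerSeries.isUnit_iff_constantCoeff] at hunit
      apply hunit.ne_zero
      rw [hF, map_add, map_pow, constantCoeff_X, zero_pow hqpos.ne', zero_add]
      -- `a(0) = 0` since `A_{d−q}` has positive order (position)
      have hA0 : constantCoeff (A ⟨d - q, hdq⟩) = 0 := by
        have hlt := hpos ⟨d - q, hdq⟩
        rw [← coeff_zero_eq_constantCoeff_apply]
        exact coeff_of_lt_order (lt_of_le_of_lt (by simp) hlt)
      rw [hρ, AlgHom.toRingHom_eq_coe, RingHom.coe_coe, MvPowerSeries.constantCoeff_rename, ha, map_mul, hA0, mul_zero])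
  · right
    have hm1' : m = 1 := le_antisymm hm1 hmpos
    refine ⟨hm1', fun i hi => hW1 i fun hdvd => ?_⟩
    -- `q = d` and `0 < i < d` is not a multiple of `q`
    have hqd : q = d := by rw [← hqm, hm1', mul_one]
    obtain ⟨j, hj⟩ := hdvd
    rcases j with _ | j
    · exact hi (by simpa using hj)
    · have := i.2
      rw [hj, hqd] at this
      exact absurd this (by nlinarith)

end TOT2Curve

end Summit.ResolutionOfSingularities.ResolutionOfSingularities.Theorems

end
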